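import Summits.BirchSwinnertonDyer.BirchSwinnertonDyer.Theorems.CyclotomicUntwistGNineConverseOrbit
import Summits.BirchSwinnertonDyer.BirchSwinnertonDyer.Theorems.CyclotomicUntwistGNineConverseRational
import Summits.BirchSwinnertonDyer.BirchSwinnertonDyer.Theorems.CyclotomicUntwistGNineConverseExtract
import Summits.BirchSwinnertonDyer.BirchSwinnertonDyer.Theorems.CyclotomicUntwistGNineRamification
import Literature.NumberTheory.EllipticCurves.LocalH1TateDualityLangTateProofs
import HarnessLib

/-!
# Converse of `GNineCriterion`: `(G₉)` at a wild additive `3` forces `Δ_min/3^v ≡ 1 (mod 3)`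

Support file for the crux `PSRankOneLowerHalfAtThree` (K1, `stmt-BirchSwinnertonDyer-21580`) of the
route `CyclotomicUntwist` (sub-problem `BirchSwinnertonDyer`).  K1 is stated on the rows with
`(w)` (`ClassO6 W 3`), `v = ord₃ Δ_min` even and unit part `Δ_min / 3^v ≡ 1 (mod 3)`; the route's
`GNineCriterion` shows these rows are of type `(G₉)` (good reduction over `ℚ(ζ₉)`).  This file
proves the CONVERSE (`mod_three_eq_one_of_typeGNine`): a class-O6 curve of type `(G₉)` has
`Δ_min / 3^v ≡ 1 (mod 3)` (with `v` even by `even_padicValInt_minimalDiscriminantInt_of_typeGNine`),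
so K1's side conditions describe EXACTLY the `(G₉)`-rows of the wild cell — the instrument that
kills the route's hypothesis (ii) as a restriction and identifies the residual item
`PSResidualNonGNineAtThree` with the non-`(G₉)` rows.

Proof (`F = X³ + AX² + BX + C` the `2`-cleared cubic, `disc F = 2⁸Δ_min = 3^v·U`): if
`U ≡ 2 (mod 3)`, good reduction over `L = ℚ(ζ₉)` yields integral `w`-adic approximate roots of
`F` in `𝓞 L` to every precision (`exists_integer_approx_root`); the Galois-orbit argument
(`orbit_dichotomy`) then produces either `U ≡ 1` or a RATIONAL `3`-adically adapted near-root,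
which `false_of_padic_approx_root` excludes (it would make `W`, or its twist by `−3`, have good
reduction at `3`).  The transfer `w(q) = exp(−6·ord₃ q)` (`e(w|3) = 6`) is `val_ratCast_eq`.

References: A. Kraus, Manuscripta Math. 69 (1990), Théorème 1; J. H. Silverman, *AEC* VII.
-/

set_option linter.dupNamespace false

open scoped NumberField

open IsDedekindDomain IsDedekindDomain.HeightOneSpectrum NumberField WeierstrassCurve WithZero
  Literature.NumberTheory.LFunctions Literature.NumberTheory.EllipticCurves
  Literature.NumberTheory.EllipticCurves.Rank1Residual Summit.BirchSwinnertonDyer.Rank1Residual.Additive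

namespace Summit.BirchSwinnertonDyer.BirchSwinnertonDyer.Theorems.GNineConverse

section Transfer

variable {L : Type} [Field L] [NumberField L] [hL : IsCyclotomicExtension {3 ^ (1 + 1)} ℚ L]
  (w : HeightOneSpectrum (𝓞 L)) (hw : (3 : 𝓞 L) ∈ w.asIdeal)
include hw

/-- **Transfer `ℚ → L_w`**: at the place `w ∋ 3` of a `9`-th cyclotomic field (`e(w|3) = 6`),
`w(q) = exp(−6·ord₃ q)` for every nonzero rational `q` (Mathlib `valuation_liesOver` and
`IsCyclotomicExtension.Rat.ramificationIdx_eq_of_prime_pow`). [cite: Washington1997, Lemma 1.4] -/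
theorem val_ratCast_eq {q : ℚ} (hq : q ≠ 0) :
    w.valuation L (q : L) = exp (-(6 * padicValRat 3 q)) := by
  haveI : Fact (Nat.Prime 3) := ⟨Nat.prime_three⟩
  set v : HeightOneSpectrum ℤ :=
    (Rat.HeightOneSpectrum.primesEquiv (R := ℤ)).symm ⟨3, Nat.prime_three⟩ with hvdef
  have hv : Rat.HeightOneSpectrum.natGenerator v = 3 :=
    congrArg Subtype.val
      ((Rat.HeightOneSpectrum.primesEquiv (R := ℤ)).apply_symm_apply ⟨3, Nat.prime_three⟩)
  have hvspan : v.asIdeal = Ideal.span {((3 : ℕ) : ℤ)} := by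
    rw [Rat.HeightOneSpectrum.asIdeal_eq_span_natGenerator_int, hv]
  haveI hlies : w.asIdeal.LiesOver (Ideal.span {((3 : ℕ) : ℤ)}) :=
    liesOver_span_of_natCast_mem 3 L w (by simpa using hw)
  haveI : w.asIdeal.LiesOver v.asIdeal := by rw [hvspan]; exact hlies
  have hpbot : Ideal.span {((3 : ℕ) : ℤ)} ≠ ⊥ := by
    rw [Ne, Ideal.span_singleton_eq_bot]; norm_num
  have he : v.asIdeal.ramificationIdx' w.asIdeal = 6 := by
    rw [hvspan, Ideal.ramificationIdx'_eq_ramificationIdx _ _ hpbot,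
      IsCyclotomicExtension.Rat.ramificationIdx_eq_of_prime_pow 3 1 L w.asIdeal]
    norm_num
  have hqL : (q : L) = algebraMap ℚ L q := (eq_ratCast _ q).symm
  rw [hqL, ← valuation_liesOver (K := ℚ) (L := L) v w q, he,
    Rat.HeightOneSpectrum.valuation_eq_exp_neg_padicValRat v hq, hv, ← exp_nsmul]
  congr 1
  simp only [nsmul_eq_mul, Nat.cast_ofNat]
  ring

end Transfer

/-! ### The converse -/

/-- **Converse of `GNineCriterion`.** A globally minimal elliptic `W/ℚ` of class O6 at `3`
(additive, `ord₃ j ≥ 0`, `f₃ ≠ 2`) which acquires good reduction over the `9`-th cyclotomic field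
at the places above `3` (`TypeGNine W`) has `Δ_min / 3^{ord₃ Δ_min} ≡ 1 (mod 3)`, i.e. `Δ_min` is a
`3`-adic square up to its (even) power of `3`.  Together with `GNineCriterion`
(`typeGNine_of_square_minimalDiscriminant`) and `even_padicValInt_minimalDiscriminantInt_of_typeGNine`
this identifies the `(G₉)`-rows of the wild cell `(w)` at `3` with the rows `v₃(Δ_min)` even,
`Δ_min/3^v ≡ 1 (mod 3)`. [cite: Kraus1990, Théorème 1 (p = 3)] -/
theorem mod_three_eq_one_of_typeGNine (W : WeierstrassCurve ℚ) [W.IsElliptic]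
    [W.IsGloballyMinimal] (hG9 : TypeGNine W) (hO6 : ClassO6 W 3) :
    W.minimalDiscriminantInt / 3 ^ padicValInt 3 W.minimalDiscriminantInt % 3 = 1 := by
  haveI hp3 : Fact (Nat.Prime 3) := ⟨Nat.prime_three⟩
  have hO6' := hO6
  obtain ⟨-, -, hpm, -⟩ := hO6
  have hev := GNineCriterion.even_padicValInt_minimalDiscriminantInt_of_typeGNine W hG9
  -- integer data
  set E₀ : WeierstrassCurve ℤ := integralModelInt W with hE₀
  set A : ℤ := E₀.b₂ with hAdef
  set B : ℤ := 8 * E₀.b₄ with hBdef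
  set C : ℤ := 16 * E₀.b₆ with hCdef
  set v : ℕ := padicValInt 3 W.minimalDiscriminantInt with hvdef
  have hmin : W.minimalDiscriminantInt = E₀.Δ := rfl
  have hΔ0 : E₀.Δ ≠ 0 := minimalDiscriminantInt_ne_zero W
  have hmapW : E₀.map (Int.castRingHom ℚ) = W := map_integralModelInt W
  have hA : (A : ℚ) = W.b₂ := by
    conv_rhs => rw [← hmapW, map_b₂]
    simp [hAdef]
  have hB : (B : ℚ) = 8 * W.b₄ := by
    conv_rhs => rw [← hmapW, map_b₄]
    simp [hBdef]
  have hC : (C : ℚ) = 16 * W.b₆ := by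
    conv_rhs => rw [← hmapW, map_b₆]
    simp [hCdef]
  -- `Δ_min = 3^v · d₀`, `3 ∤ d₀`
  obtain ⟨d₀, hd₀⟩ : (3 : ℤ) ^ v ∣ E₀.Δ :=
    (three_pow_dvd_iff v E₀.Δ).mpr (Or.inr (by rw [hvdef, hmin]))
  have hd₀' : W.minimalDiscriminantInt / 3 ^ v = d₀ := by
    rw [hmin, hd₀, Int.mul_ediv_cancel_left _ (pow_ne_zero _ (by norm_num))]
  rw [hd₀']
  have hd3 : ¬ (3 : ℤ) ∣ d₀ := by
    intro h
    have h' : (3 : ℤ) ^ (v + 1) ∣ E₀.Δ := by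
      rw [hd₀, pow_succ]; exact mul_dvd_mul_left _ h
    rcases (three_pow_dvd_iff (v + 1) E₀.Δ).mp h' with h0 | hle
    · exact hΔ0 h0
    · rw [← hmin, ← hvdef] at hle; omega
  by_contra hne
  have hd2 : d₀ % 3 = 2 := by omega
  set U : ℤ := 256 * d₀ with hUdef
  have hU2 : (3 : ℤ) ∣ U - 2 := by rw [hUdef]; omega
  have hU3 : ¬ (3 : ℤ) ∣ U := by rw [hUdef]; omega
  have hU1 : ¬ (3 : ℤ) ∣ U - 1 := by rw [hUdef]; omega
  have hD : A ^ 2 * B ^ 2 - 4 * B ^ 3 - 4 * A ^ 3 * C - 27 * C ^ 2 + 18 * A * B * C =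
      3 ^ v * U := by
    rw [hUdef, show (3 : ℤ) ^ v * (256 * d₀) = 256 * (3 ^ v * d₀) by ring, ← hd₀]
    exact disc_b_eq E₀
  have hDQ : (A : ℚ) ^ 2 * B ^ 2 - 4 * B ^ 3 - 4 * A ^ 3 * C - 27 * C ^ 2 + 18 * A * B * C =
      3 ^ v * U := by exact_mod_cast hD
  -- `3·ord₃ c₄ ≥ v` from `ord₃ j ≥ 0`
  have hc4E : E₀.c₄ = A ^ 2 - 3 * B := c₄_eq_b₂_sq_sub E₀
  have hc4v : E₀.c₄ = 0 ∨ (v : ℤ) ≤ 3 * padicValInt 3 E₀.c₄ := by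
    by_cases hc0 : E₀.c₄ = 0
    · exact Or.inl hc0
    right
    have hj : 0 ≤ padicValRat 3 W.j := not_lt.mp hpm
    have hc : W.c₄ = (E₀.c₄ : ℚ) := by
      conv_lhs => rw [← hmapW, map_c₄]
      simp
    have hΔ : W.Δ = (E₀.Δ : ℚ) := by
      conv_lhs => rw [← hmapW, map_Δ]
      simp
    have hjq : W.j = W.c₄ ^ 3 / W.Δ := by
      rw [WeierstrassCurve.j, ← coe_Δ', div_eq_inv_mul, Units.val_inv_eq_inv_val]
    rw [hjq, hc, hΔ, padicValRat.div (pow_ne_zero _ (by exact_mod_cast hc0)) (by exact_mod_cast hΔ0),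
      padicValRat.pow, padicValRat.of_int, padicValRat.of_int, ← hmin, ← hvdef] at hj
    push_cast at hj
    linarith
  -- the field `L ⊇ ℚ(ζ₉)` and a place `w ∋ 3`
  obtain ⟨L, _, _, hcycL, F, hF⟩ := hG9
  haveI : NumberField F := NumberField.of_module_finite ℚ F
  haveI hcyc : IsCyclotomicExtension {3 ^ (1 + 1)} ℚ L := by
    rw [show (3 : ℕ) ^ (1 + 1) = 9 by norm_num]; exact hcycL
  obtain ⟨w, hw⟩ := exists_heightOneSpectrum_natCast_mem L 3
  have hw3 : (3 : 𝓞 L) ∈ w.asIdeal := by simpa using hw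
  -- good reduction of `W/L` at `w`, from good reduction over `F` at the place below `w`
  have hgoodL : (W.baseChange L).HasGoodReductionAt w := by
    have hPprime : (w.asIdeal.under (𝓞 F)).IsPrime := inferInstance
    have h3P : (3 : 𝓞 F) ∈ w.asIdeal.under (𝓞 F) := by
      rw [Ideal.under_def, Ideal.mem_comap, map_ofNat]; exact hw3
    have hP0 : w.asIdeal.under (𝓞 F) ≠ ⊥ := by
      intro h0
      rw [h0, Ideal.mem_bot] at h3P
      have h3F := congrArg (fun x : 𝓞 F ↦ (x : F)) h3P
      norm_num at h3F
    set wF : HeightOneSpectrum (𝓞 F) := ⟨w.asIdeal.under (𝓞 F), hPprime, hP0⟩ with hwF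
    haveI : w.asIdeal.LiesOver wF.asIdeal := ⟨rfl⟩
    have hgoodF : (W.baseChange F).HasGoodReductionAt wF := hF wF h3P
    have h := hasGoodReductionAt_baseChange_of_hasGoodReductionAt (W.baseChange F) L wF w hgoodF
    have e : (W.baseChange F).baseChange L = W.baseChange L := by
      rw [WeierstrassCurve.baseChange, WeierstrassCurve.baseChange, WeierstrassCurve.baseChange,
        WeierstrassCurve.map_map, ← IsScalarTower.algebraMap_eq]
    rwa [e] at h
  -- an integral `w`-adic approximate root of `F`, to precision `10 v + 8`
  obtain ⟨R, hR⟩ :=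
    exists_integer_approx_root w hw3 W hgoodL A B C hA hB hC v U hev hU2 hDQ (10 * v + 8)
  -- valuations at `w` of the integer data
  have hval3v : w.valuation L ((3 : L) ^ v) = exp (-(6 * (v : ℤ))) := val_three_pow w hw3 v
  have hvalU : w.valuation L ((U : ℤ) : L) = 1 := (GNineCriterion.placeData_nine w hw3).2.2 U hU3
  have hvD : w.valuation L ((3 : L) ^ v * U) = exp (-(6 * (v : ℤ))) := by
    rw [map_mul, hval3v, hvalU, mul_one]
  have hpg : w.valuation L (((A ^ 2 - 3 * B : ℤ) : L)) ^ 3 ≤ w.valuation L ((3 : L) ^ v * U) := by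
    by_cases hc0 : E₀.c₄ = 0
    · rw [← hc4E, hc0]; simp
    · have hle := hc4v.resolve_left hc0
      have hcast : (((A ^ 2 - 3 * B : ℤ) : L)) = (((E₀.c₄ : ℚ)) : L) := by
        rw [← hc4E]; push_cast; ring
      rw [hcast, val_ratCast_eq w hw3 (by exact_mod_cast hc0), padicValRat.of_int, hvD, ← exp_nsmul,
        exp_le_exp]
      simp only [nsmul_eq_mul, Nat.cast_ofNat]
      linarith
  -- the orbit dichotomy
  rcases orbit_dichotomy w hw3 A B C v U hev hU3 hD hpg R (10 * v + 8) (by omega) hR with h1 | ⟨S, hS⟩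
  · exact hU1 h1
  -- the rational branch: read `S` `3`-adically and apply `false_of_padic_approx_root`
  have hA1 := GNineCriterion.val_intCast_le w A
  have hB1 := GNineCriterion.val_intCast_le w B
  have hC1 := GNineCriterion.val_intCast_le w C
  have h2 : w.valuation L (2 : L) = 1 := by
    have := (GNineCriterion.placeData_nine w hw3).2.2 2 (by norm_num); simpa using this
  have hDL : (A : L) ^ 2 * B ^ 2 - 4 * B ^ 3 - 4 * A ^ 3 * C - 27 * C ^ 2 + 18 * A * B * C =
      (3 : L) ^ v * U := by exact_mod_cast hD
  have hprec : exp (-((10 * v + 8 : ℕ) : ℤ) + 4 * v + 6) = exp (-(6 * (v : ℤ) + 2)) := by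
    congr 1; push_cast; ring
  rw [hprec] at hS
  have hS1 : w.valuation L (S : L) ≤ 1 := by
    refine val_le_one_of_val_eval_le_one hA1 hB1 hC1 (hS.trans ?_)
    rw [← exp_zero, exp_le_exp]; omega
  have hclt : w.valuation L ((S : L) ^ 3 + A * (S : L) ^ 2 + B * (S : L) + C) <
      w.valuation L ((A : L) ^ 2 * B ^ 2 - 4 * B ^ 3 - 4 * A ^ 3 * C - 27 * C ^ 2 +
        18 * A * B * C) := by
    rw [hDL, hvD]
    refine lt_of_le_of_lt hS ?_
    rw [exp_lt_exp]; omega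
  have hpg' : w.valuation L ((A : L) ^ 2 - 3 * B) ^ 3 ≤ w.valuation L ((A : L) ^ 2 * B ^ 2 -
      4 * B ^ 3 - 4 * A ^ 3 * C - 27 * C ^ 2 + 18 * A * B * C) := by
    rw [hDL]; push_cast at hpg; exact hpg
  obtain ⟨hb3, -, hab⟩ := val_deriv_pow_three_eq hA1 hB1 hC1 hS1 h2 hpg' hclt
  rw [hDL, hvD] at hb3
  have hbS : w.valuation L (3 * (S : L) ^ 2 + 2 * A * (S : L) + B) = exp (-(2 * (v : ℤ))) :=
    eq_exp_of_pow_three_eq hb3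
  have haS : w.valuation L (3 * (S : L) + A) ≤ exp (-(v : ℤ)) :=
    le_exp_of_sq_le (by rw [← hbS]; exact hab)
  -- translate to `ord₃`
  have hbQ : ((3 * S ^ 2 + 2 * (A : ℚ) * S + B : ℚ) : L) = 3 * (S : L) ^ 2 + 2 * A * (S : L) + B := by
    push_cast; ring
  have haQ : ((3 * S + (A : ℚ) : ℚ) : L) = 3 * (S : L) + A := by push_cast; ring
  have hcQ : ((S ^ 3 + (A : ℚ) * S ^ 2 + B * S + C : ℚ) : L) =
      (S : L) ^ 3 + A * (S : L) ^ 2 + B * (S : L) + C := by push_cast; ring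
  have hb0 : (3 * S ^ 2 + 2 * (A : ℚ) * S + B : ℚ) ≠ 0 := by
    intro h0
    have : w.valuation L (3 * (S : L) ^ 2 + 2 * A * (S : L) + B) = 0 := by
      rw [← hbQ, h0, Rat.cast_zero, map_zero]
    rw [this] at hbS; exact exp_ne_zero hbS.symm
  have hb : 3 * padicValRat 3 (3 * S ^ 2 + 2 * (A : ℚ) * S + B) =
      (padicValInt 3 W.minimalDiscriminantInt : ℤ) := by
    have h := val_ratCast_eq w hw3 hb0
    rw [hbQ, hbS, exp_inj] at h
    rw [← hvdef]; linarith
  have ha : 3 * S + (A : ℚ) = 0 ∨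
      (padicValInt 3 W.minimalDiscriminantInt : ℤ) ≤ 6 * padicValRat 3 (3 * S + (A : ℚ)) := by
    by_cases ha0 : 3 * S + (A : ℚ) = 0
    · exact Or.inl ha0
    right
    have h := val_ratCast_eq w hw3 ha0
    rw [haQ] at h
    rw [h, exp_le_exp] at haS
    rw [← hvdef]; linarith
  have hc : S ^ 3 + (A : ℚ) * S ^ 2 + B * S + C = 0 ∨
      (padicValInt 3 W.minimalDiscriminantInt : ℤ) ≤
        2 * padicValRat 3 (S ^ 3 + (A : ℚ) * S ^ 2 + B * S + C) := by
    by_cases hc0 : S ^ 3 + (A : ℚ) * S ^ 2 + B * S + C = 0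
    · exact Or.inl hc0
    right
    have h := val_ratCast_eq w hw3 hc0
    rw [hcQ] at h
    rw [h, exp_le_exp] at hS
    rw [← hvdef]
    have hv0 : (0 : ℤ) ≤ v := by positivity
    linarith
  exact false_of_padic_approx_root W hO6' hev (A : ℚ) B C S hA hB hC hb ha hc

end Summit.BirchSwinnertonDyer.BirchSwinnertonDyer.Theorems.GNineConverse
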